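import Summits.CriticalPhenomena.PercolationContinuityZ3.Theorems.PercNearOneGluingNoHeavyQuantTwoPointPairRouteHigherD
import Summits.CriticalPhenomena.PercolationContinuityZ3.Theorems.PercNearOneGluingNoHeavyQuantTwoPointPairRouteBallCritZ3
import HarnessLib

/-!
# QUANT lane / PAPER-2 rate track (ARM-2, gen 10): THE PAIR-ROUTE ROWS WITH d-UNIFORM CLOSED-FORM CONSTANTS (every `d ≥ 3`)

builds on p205010 (kernel theorem, internal audit signed; external expert review pending)

Cell `prim-quant`, seat `prim-quant-arm-2` (constants bookkeeper), memo `RATE-CONSTANTS.md` §5.7.  One printed sentence per route for ALL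
`d ≥ 3` at once, complementing the `d = 3..6` numeral tables (`…PairRouteZ3/BallZ3/BallCritZ3`, `…PairRouteHigherD/HigherDTable`):

* §1 `Quant.aknKappa_window_le_uniform`: **`κ_d = aknKappa d (1/(2d)) ≤ 2^{5d⁴+5d+5} = 32^{d⁴+d+1}`** for every `d ≥ 3` (Cerf's two-arms
  constant in the window `[1/(2d), 1−1/(2d)] ∋ p_c(ℤ^d)`: `exp((2d+½)²/(8δ²(1−δ)²)) = exp(d⁴(4d+1)²/(2(2d−1)²)) ≤ 2^{5d⁴}` because
  `13(4d+1)² ≤ 90(2d−1)²` for `d ≥ 3`; prefactor `32d³3^d ≤ 2^{5d+5}`; sharp order `2^{2.885d⁴(1+O(1/d))}`, tight at `d = 3`: `2^{425}` vs `2^{409.5}`);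
* §2 **pointwise hypothesis** `τ_{p_c}(0,x) ≤ C‖x‖^{−b}` ⟹ `OneArmPolyDecayAtCritical d (min(b,1)/(12d+4)) (2^{2d⁴} + 3√C)`
  (`K_d³ ≤ 2^{5d⁴+17d+14} ≤ 2^{3(2d⁴−1)}` since `d⁴ ≥ 17d+17`);
* §3 **X_A (ball hypothesis), bootstrap pair route** ⟹ `OneArmPolyDecayAtCritical d (min(a,1)/(8d²+4d+6)) (2^{d⁴} + 3√C)`
  (`K′_d^{2d+2} ≤ 2^{5d⁴+10d²+12d+14} ≤ 2^{(2d+2)(d⁴−1)}`);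
* §4 **X_A, φ-pair route** ⟹ `OneArmPolyDecayAtCritical d (min(a,1)/(8d²+8)) (2^{3d⁴+d³} + 2√C)` (`d = 3` from gen 9's `K″_3 ≤ 2^528 ≤ 2^538`;
  `d ≥ 4`: `K″_d ≤ 2^{5d⁴+12d²+13d+11} ≤ 2^{2(3d⁴+d³−1)}`).
So for every `d ≥ 3`, in one line each: `π_{p_c(ℤ^d)}(n) ≤ (4^{d⁴} + 3√C)·n^{−b′/(12d+4)}` (pointwise), `≤ (2^{d⁴} + 3√C)·n^{−a′/(8d²+4d+6)}` and
`≤ (2^{d³(3d+1)} + 2√C)·n^{−a′/(8d²+8)}` (X_A).  Only `n < 2^n` (`Nat.lt_two_pow_self`), `5³ ≤ 2⁷`, `7 ≤ 8`, `3·4 ≤ 16`-type comparisons enter.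
Second derivation: `run/shared/lean/prim/quant/prim-quant-arm-2-g10/code/higher_d.py` (exact, all `3 ≤ d ≤ 60`).
HONEST FRAMING: implications from OPEN inputs (pointwise two-point decay / X_A at `p_c(ℤ^d)`); the unconditional rate (class log*) and the
honest sentence are UNCHANGED; the closed forms are upper bounds chosen for legibility, the tables carry the near-sharp numerals.
[cite: Cerf2015, Prop. 5.2, Lemma 7.1 and §10] [cite: DuminilcopinKozmaTassion2020, §7 (38)–(40)] [cite: DuminilCopinTassionEM2016, Thm. 1.1]
[cite: HeydenreichVanDerHofstad2017, Open Problem 10.1]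
-/

noncomputable section

namespace Summit.CriticalPhenomena.PercolationContinuityZ3.Theorems.Quant

open MeasureTheory Literature.Probability.Percolation Literature.Probability.LatticeModels
open Summit.CriticalPhenomena.PercolationContinuityZ3.Theorems.SurfaceTension
open Literature.Probability.Percolation.AKN
open scoped Classical

variable {d : ℕ}

/-! ## §0. Polynomial-versus-exponential comparisons in `d` (all from `n < 2^n`) -/

/-- `d^k ≤ 2^{k d}` (real form of `d < 2^d`). [folklore] -/
theorem natCast_pow_le_two_pow_mul (d k : ℕ) : (d : ℝ) ^ k ≤ (2 : ℝ) ^ (k * d) := by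
  have h : (d : ℝ) ≤ (2 : ℝ) ^ d := by exact_mod_cast (Nat.lt_two_pow_self (n := d)).le
  calc (d : ℝ) ^ k ≤ ((2 : ℝ) ^ d) ^ k := pow_le_pow_left₀ (Nat.cast_nonneg d) h k
    _ = (2 : ℝ) ^ (k * d) := by rw [← pow_mul, mul_comm]

/-- `2d ≤ 2^d` for `d ≥ 1` (from `d − 1 < 2^{d−1}`). [folklore] -/
theorem two_mul_natCast_le_two_pow (hd : 1 ≤ d) : 2 * (d : ℝ) ≤ (2 : ℝ) ^ d := by
  have h : d - 1 < 2 ^ (d - 1) := Nat.lt_two_pow_self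
  have h2 : 2 * d ≤ 2 ^ d := by
    have : d ≤ 2 ^ (d - 1) := by omega
    calc 2 * d ≤ 2 * 2 ^ (d - 1) := Nat.mul_le_mul_left 2 this
      _ = 2 ^ d := by rw [← pow_succ']; congr 1; omega
  exact_mod_cast h2

/-- `(2d)^k ≤ 2^{d k}` for `d ≥ 1`. [folklore] -/
theorem two_mul_natCast_pow_le (hd : 1 ≤ d) (k : ℕ) : (2 * (d : ℝ)) ^ k ≤ (2 : ℝ) ^ (d * k) := by
  calc (2 * (d : ℝ)) ^ k ≤ ((2 : ℝ) ^ d) ^ k := pow_le_pow_left₀ (by positivity) (two_mul_natCast_le_two_pow hd) k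
    _ = (2 : ℝ) ^ (d * k) := by rw [← pow_mul]

/-- `5^{3d−1} ≤ 2^{7d}` (`125 ≤ 128`). [folklore] -/
theorem five_pow_le_two_pow (d : ℕ) : (5 : ℝ) ^ (3 * d - 1) ≤ (2 : ℝ) ^ (7 * d) := by
  calc (5 : ℝ) ^ (3 * d - 1) ≤ (5 : ℝ) ^ (3 * d) := pow_le_pow_right₀ (by norm_num) (by omega)
    _ = (125 : ℝ) ^ d := by rw [pow_mul]; norm_num
    _ ≤ (128 : ℝ) ^ d := pow_le_pow_left₀ (by norm_num) (by norm_num) d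
    _ = (2 : ℝ) ^ (7 * d) := by rw [pow_mul]; norm_num

/-- `7^{2d²} ≤ 2^{6d²}` (`7 ≤ 8`). [folklore] -/
theorem seven_pow_le_two_pow (d : ℕ) : (7 : ℝ) ^ (2 * d ^ 2) ≤ (2 : ℝ) ^ (6 * d ^ 2) := by
  calc (7 : ℝ) ^ (2 * d ^ 2) ≤ (8 : ℝ) ^ (2 * d ^ 2) := pow_le_pow_left₀ (by norm_num) (by norm_num) _
    _ = (2 : ℝ) ^ (6 * d ^ 2) := by rw [show (8 : ℝ) = 2 ^ 3 by norm_num, ← pow_mul]; ring_nf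

/-! ## §1. `κ_d ≤ 2^{5d⁴+5d+5}` for every `d ≥ 3` -/

/-- **Cerf's two-arms constant at the window `1/(2d)`, closed form: `aknKappa d (1/(2d)) ≤ 2^{5d⁴+5d+5} = 32^{d⁴+d+1}` for every `d ≥ 3`.**
The exponential factor `exp((2d+½)²/(8δ²(1−δ)²))`, `δ = 1/(2d)`, equals `exp(d⁴(4d+1)²/(2(2d−1)²))` and is `≤ 2^{5d⁴}` because
`13(4d+1)² ≤ 90(2d−1)²` for `d ≥ 3` (with `e⁹ ≤ 2¹³`); the prefactor `3^d·16d²/δ = 32d³3^d ≤ 2^{5d+5}`; the middle term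
`3^d√(8d²3^{d−1}) ≤ 2^{4d+2}`.  (`d = 3..6`: true `log₂ κ_d = 409.5, 1106.5, 2474.5, 4851.1` vs `425, 1305, 3155, 6515`.)
builds on p205010 (kernel theorem, internal audit signed; external expert review pending). [cite: Cerf2015, Prop 5.2] -/
theorem aknKappa_window_le_uniform (hd : 3 ≤ d) : aknKappa d (1 / (2 * (d : ℝ))) ≤ (2 : ℝ) ^ (5 * d ^ 4 + 5 * d + 5) := by
  have hd1 : 1 ≤ d := le_trans (by norm_num) hd
  have hx3 : (3 : ℝ) ≤ d := by exact_mod_cast hd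
  have hx0 : (0 : ℝ) < d := by linarith
  have hδ0 : (0 : ℝ) < 1 / (2 * (d : ℝ)) := by positivity
  refine aknKappa_le_of_window d hδ0 (e := 5 * d ^ 4) (a₁ := 5 * d + 5) (a₂ := 4 * d + 2) ?_ ?_ ?_ ?_ ?_ ?_
  · -- `13 E ≤ 9 · 5d⁴`
    have key : (4 * (2 * (1 / (2 * (d : ℝ))) ^ 2 * (1 - 1 / (2 * (d : ℝ))) ^ 2)) = (2 * (d : ℝ) - 1) ^ 2 / (2 * (d : ℝ) ^ 4) := by
      field_simp
      ring
    have hpos : 0 < (2 * (d : ℝ) - 1) ^ 2 := by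
      have : 0 < 2 * (d : ℝ) - 1 := by linarith
      positivity
    rw [key, div_div_eq_mul_div, ← mul_div_assoc, div_le_iff₀ hpos]
    push_cast
    have h76 : 0 ≤ 76 * (d : ℝ) ^ 2 - 232 * d + 77 / 2 := by nlinarith [sq_nonneg ((d : ℝ) - 3)]
    have hx4 : 0 ≤ (d : ℝ) ^ 4 := by positivity
    have hprod := mul_nonneg hx4 h76
    nlinarith [hprod, hx4]
  · -- prefactor `3^d · 32 d³ ≤ 2^{5d+5}`
    have h3 : (3 : ℝ) ^ d * (16 * (d : ℝ) ^ 2 / (1 / (2 * (d : ℝ)))) = 32 * ((3 : ℝ) ^ d * (d : ℝ) ^ 3) := by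
      field_simp
      ring
    rw [h3, show 5 * d + 5 = 5 + (2 * d + 3 * d) by ring, pow_add, pow_add]
    refine mul_le_mul (by norm_num) (mul_le_mul ?_ (natCast_pow_le_two_pow_mul d 3) (by positivity) (by positivity))
      (by positivity) (by norm_num)
    calc (3 : ℝ) ^ d ≤ (4 : ℝ) ^ d := pow_le_pow_left₀ (by norm_num) (by norm_num) d
      _ = (2 : ℝ) ^ (2 * d) := by rw [pow_mul]; norm_num
  · -- middle term `(3^d)² · 8d² · 3^{d−1} ≤ 2^{2(4d+2)}`
    have h1 : (3 : ℝ) ^ (d - 1) ≤ (3 : ℝ) ^ d := pow_le_pow_right₀ (by norm_num) (Nat.sub_le d 1)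
    have h2 : (d : ℝ) ^ 2 ≤ (2 : ℝ) ^ (2 * d) := natCast_pow_le_two_pow_mul d 2
    have h27 : ((3 : ℝ) ^ d) ^ 2 * (3 : ℝ) ^ d = (27 : ℝ) ^ d := by rw [← pow_mul, ← pow_add]; rw [show d * 2 + d = 3 * d by ring, pow_mul]; norm_num
    calc ((3 : ℝ) ^ d) ^ 2 * (8 * (d : ℝ) ^ 2 * (3 : ℝ) ^ (d - 1))
        ≤ ((3 : ℝ) ^ d) ^ 2 * (8 * (2 : ℝ) ^ (2 * d) * (3 : ℝ) ^ d) := by gcongr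
      _ = 8 * (2 : ℝ) ^ (2 * d) * (27 : ℝ) ^ d := by rw [← h27]; ring
      _ ≤ 8 * (2 : ℝ) ^ (2 * d) * (32 : ℝ) ^ d := by gcongr; norm_num
      _ = (2 : ℝ) ^ (3 + 2 * d + 5 * d) := by
          rw [pow_add, pow_add, show (32 : ℝ) = 2 ^ 5 by norm_num, ← pow_mul]; norm_num
      _ ≤ (2 : ℝ) ^ (2 * (4 * d + 2)) := pow_le_pow_right₀ (by norm_num) (by omega)
  · exact le_of_eq (by ring)
  · nlinarith [Nat.zero_le (d ^ 4)]
  · nlinarith [Nat.zero_le (d ^ 4)]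

/-! ## §1b. Monotonicity of products and exponent budgets (all from `n < 2^n`) -/

/-- Product of four nonnegative bounds. [folklore] -/
theorem mul4_le_mul4 {a₁ a₂ a₃ a₄ b₁ b₂ b₃ b₄ : ℝ} (h₁ : a₁ ≤ b₁) (h₂ : a₂ ≤ b₂) (h₃ : a₃ ≤ b₃) (h₄ : a₄ ≤ b₄)
    (n₁ : 0 ≤ a₁) (n₂ : 0 ≤ a₂) (n₃ : 0 ≤ a₃) (n₄ : 0 ≤ a₄) : a₁ * a₂ * a₃ * a₄ ≤ b₁ * b₂ * b₃ * b₄ := by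
  have e₁ := n₁.trans h₁
  have e₂ := n₂.trans h₂
  have e₃ := n₃.trans h₃
  have s2 : a₁ * a₂ ≤ b₁ * b₂ := mul_le_mul h₁ h₂ n₂ e₁
  have s3 : a₁ * a₂ * a₃ ≤ b₁ * b₂ * b₃ := mul_le_mul s2 h₃ n₃ (mul_nonneg e₁ e₂)
  exact mul_le_mul s3 h₄ n₄ (mul_nonneg (mul_nonneg e₁ e₂) e₃)

/-- Product of six nonnegative bounds. [folklore] -/
theorem mul6_le_mul6 {a₁ a₂ a₃ a₄ a₅ a₆ b₁ b₂ b₃ b₄ b₅ b₆ : ℝ} (h₁ : a₁ ≤ b₁) (h₂ : a₂ ≤ b₂) (h₃ : a₃ ≤ b₃) (h₄ : a₄ ≤ b₄)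
    (h₅ : a₅ ≤ b₅) (h₆ : a₆ ≤ b₆) (n₁ : 0 ≤ a₁) (n₂ : 0 ≤ a₂) (n₃ : 0 ≤ a₃) (n₄ : 0 ≤ a₄) (n₅ : 0 ≤ a₅) (n₆ : 0 ≤ a₆) :
    a₁ * a₂ * a₃ * a₄ * a₅ * a₆ ≤ b₁ * b₂ * b₃ * b₄ * b₅ * b₆ := by
  have s4 := mul4_le_mul4 h₁ h₂ h₃ h₄ n₁ n₂ n₃ n₄
  have e4 : 0 ≤ b₁ * b₂ * b₃ * b₄ := (mul_nonneg (mul_nonneg (mul_nonneg n₁ n₂) n₃) n₄).trans s4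
  have s5 : a₁ * a₂ * a₃ * a₄ * a₅ ≤ b₁ * b₂ * b₃ * b₄ * b₅ := mul_le_mul s4 h₅ n₅ e4
  exact mul_le_mul s5 h₆ n₆ (mul_nonneg e4 (n₅.trans h₅))

/-- `20√2 ≤ 2^5`, `10√2 ≤ 2^4`, `5√2 ≤ 2^3` (`√2 ≤ 3/2`). [folklore] -/
theorem sqrt_two_mul_le : 20 * Real.sqrt 2 ≤ (2 : ℝ) ^ 5 ∧ 10 * Real.sqrt 2 ≤ (2 : ℝ) ^ 4 ∧ 5 * Real.sqrt 2 ≤ (2 : ℝ) ^ 3 := by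
  have hs : Real.sqrt 2 ≤ 3 / 2 := (Real.sqrt_le_sqrt (by norm_num : (2 : ℝ) ≤ (3 / 2) ^ 2)).trans
    (by rw [Real.sqrt_sq (by norm_num)])
  refine ⟨?_, ?_, ?_⟩ <;> nlinarith [hs]

/-- Exponent budget of the pointwise row: `5d⁴ + 17d + 14 ≤ 3(2d⁴ − 1)` for `d ≥ 3`. [folklore] -/
theorem budget_pointwise (hd : 3 ≤ d) : 5 + (5 * d + 4) + 7 * d + (5 * d ^ 4 + 5 * d + 5) ≤ 3 * (2 * d ^ 4 - 1) := by
  have h27 : 27 ≤ d ^ 3 := by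
    calc 27 = 3 ^ 3 := by norm_num
      _ ≤ d ^ 3 := Nat.pow_le_pow_left hd 3
  have h4 : d ^ 4 = d ^ 3 * d := by ring
  have h27d : 27 * d ≤ d ^ 4 := by rw [h4]; exact Nat.mul_le_mul_right d h27
  omega

/-- Exponent budget of the bootstrap ball row: `5d⁴ + 10d² + 12d + 14 ≤ (2d+2)(d⁴ − 1)` for `d ≥ 3`. [folklore] -/
theorem budget_ball (hd : 3 ≤ d) :
    4 + 3 * d + d * (4 * d + 2) + (2 * d + 5) + 6 * d ^ 2 + (5 * d ^ 4 + 5 * d + 5) ≤ (2 * d + 2) * (d ^ 4 - 1) := by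
  have hs3 : 3 * d ≤ d ^ 2 := by nlinarith
  have h9 : 9 * d ^ 2 ≤ d ^ 4 := by nlinarith [hs3]
  have hpos : 1 ≤ d ^ 4 := Nat.one_le_pow _ _ (by omega)
  obtain ⟨k, hk⟩ : ∃ k, d ^ 4 = k + 1 := ⟨d ^ 4 - 1, by omega⟩
  have h8 : 8 * k ≤ (2 * d + 2) * k := Nat.mul_le_mul_right k (by omega)
  rw [hk, Nat.add_sub_cancel]
  have hlin : 4 + 3 * d + d * (4 * d + 2) + (2 * d + 5) + 6 * d ^ 2 + (5 * (k + 1) + 5 * d + 5) ≤ 8 * k := by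
    have e : d * (4 * d + 2) = 4 * d ^ 2 + 2 * d := by ring
    rw [e]; omega
  exact hlin.trans h8

/-- Exponent budget of the φ-pair row: `5d⁴ + 12d² + 13d + 11 ≤ 2(3d⁴ + d³ − 1)` for `d ≥ 4`. [folklore] -/
theorem budget_phi (hd : 4 ≤ d) :
    3 + 3 * d + d * (6 * d + 2) + (2 * d + 3) + 6 * d ^ 2 + (5 * d ^ 4 + 5 * d + 5) ≤ 2 * (3 * d ^ 4 + d ^ 3 - 1) := by
  have hs4 : 4 * d ≤ d ^ 2 := by nlinarith
  have h16 : 16 * d ^ 2 ≤ d ^ 4 := by nlinarith [hs4]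
  have h16' : 16 * d ≤ d ^ 3 := by nlinarith [hs4]
  have e : d * (6 * d + 2) = 6 * d ^ 2 + 2 * d := by ring
  rw [e]; omega

/-! ## §2. Pointwise hypothesis, every `d ≥ 3`: constant `2^{2d⁴} + 3√C` -/

/-- **`K_d ≤ 2^{2d⁴−1}` for every `d ≥ 3`** (`K_d³ = 20√2·d⁴(12d+4)·5^{3d−1}·κ_d ≤ 2^5·2^{5d+4}·2^{7d}·2^{5d⁴+5d+5}`).
[cite: Cerf2015, Prop. 5.2] [cite: DuminilcopinKozmaTassion2020, §7 (38)] -/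
theorem pairConst_le_uniform (hd : 3 ≤ d) :
    (20 * Real.sqrt 2 * (d : ℝ) ^ 4 * (12 * (d : ℝ) + 4) * 5 ^ (3 * d - 1) * aknKappa d (1 / (2 * (d : ℝ)))) ^ (1 / 3 : ℝ) ≤
      (2 : ℝ) ^ (2 * d ^ 4 - 1) := by
  have hx1 : (1 : ℝ) ≤ d := by exact_mod_cast (le_trans (by norm_num) hd : 1 ≤ d)
  have hκ := aknKappa_window_le_uniform hd
  have hκ0 : 0 ≤ aknKappa d (1 / (2 * (d : ℝ))) := le_trans (by norm_num) (three_le_aknKappa d _)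
  have hb : (d : ℝ) ^ 4 * (12 * (d : ℝ) + 4) ≤ (2 : ℝ) ^ (5 * d + 4) := by
    have h5 := natCast_pow_le_two_pow_mul d 5
    calc (d : ℝ) ^ 4 * (12 * (d : ℝ) + 4) ≤ (d : ℝ) ^ 4 * (16 * (d : ℝ)) := by gcongr; linarith
      _ = 16 * (d : ℝ) ^ 5 := by ring
      _ ≤ 16 * (2 : ℝ) ^ (5 * d) := by linarith
      _ = (2 : ℝ) ^ (5 * d + 4) := by rw [pow_add]; norm_num; ring
  have hmain : 20 * Real.sqrt 2 * (d : ℝ) ^ 4 * (12 * (d : ℝ) + 4) * 5 ^ (3 * d - 1) * aknKappa d (1 / (2 * (d : ℝ))) ≤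
      (2 : ℝ) ^ (3 * (2 * d ^ 4 - 1)) := by
    have hre : 20 * Real.sqrt 2 * (d : ℝ) ^ 4 * (12 * (d : ℝ) + 4) * 5 ^ (3 * d - 1) * aknKappa d (1 / (2 * (d : ℝ))) =
        (20 * Real.sqrt 2) * ((d : ℝ) ^ 4 * (12 * (d : ℝ) + 4)) * 5 ^ (3 * d - 1) * aknKappa d (1 / (2 * (d : ℝ))) := by ring
    rw [hre]
    calc (20 * Real.sqrt 2) * ((d : ℝ) ^ 4 * (12 * (d : ℝ) + 4)) * 5 ^ (3 * d - 1) * aknKappa d (1 / (2 * (d : ℝ)))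
        ≤ (2 : ℝ) ^ 5 * (2 : ℝ) ^ (5 * d + 4) * (2 : ℝ) ^ (7 * d) * (2 : ℝ) ^ (5 * d ^ 4 + 5 * d + 5) :=
          mul4_le_mul4 sqrt_two_mul_le.1 hb (five_pow_le_two_pow d) hκ (by positivity) (by positivity) (by positivity) hκ0
      _ = (2 : ℝ) ^ (5 + (5 * d + 4) + 7 * d + (5 * d ^ 4 + 5 * d + 5)) := by rw [← pow_add, ← pow_add, ← pow_add]
      _ ≤ (2 : ℝ) ^ (3 * (2 * d ^ 4 - 1)) := pow_le_pow_right₀ (by norm_num) (budget_pointwise hd)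
  rw [show (1 / 3 : ℝ) = 1 / ((3 : ℕ) : ℝ) by norm_num]
  exact rpow_one_div_le_two_pow (by norm_num) (mul_nonneg (by positivity) hκ0) hmain

/-- **POINTWISE ⟹ (T1), PAIR ROUTE, CLOSED FORM FOR EVERY `d ≥ 3`**: `τ_{p_c}(0,x) ≤ C‖x‖^{−b}` (`x ≠ 0`, `b > 0`) ⟹
`OneArmPolyDecayAtCritical d (min(b,1)/(12d+4)) (2^{2d⁴} + 3√C)`, i.e. **`π_{p_c(ℤ^d)}(n) ≤ (4^{d⁴} + 3√C)·n^{−min(b,1)/(12d+4)}`** for all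
`n ≥ 1` (`d = 3..6` numerals: `2^150, 2^386, 2^845, 2^1641` in place of `4^{d⁴} = 2^162, 2^512, 2^1250, 2^2592`).
builds on p205010 (kernel theorem, internal audit signed; external expert review pending).
[cite: Cerf2015, Prop. 5.2, Lemma 7.1 and §10] [cite: DuminilcopinKozmaTassion2020, §7 (38)–(39)] [cite: HeydenreichVanDerHofstad2017, Open Problem 10.1] -/
theorem oneArmPolyDecayAtCritical_of_pointwiseTwoPoint_pair_uniform (hd : 3 ≤ d) {b C : ℝ} (hb0 : 0 < b)
    (hτ : ∀ x : Site d, x ≠ 0 → tau d (criticalProbI d) 0 x ≤ C * ‖x‖ ^ (-b)) :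
    OneArmPolyDecayAtCritical d (min b 1 / (12 * (d : ℝ) + 4)) ((2 : ℝ) ^ (2 * d ^ 4) + 3 * Real.sqrt C) := by
  have hx3 : (3 : ℝ) ≤ d := by exact_mod_cast hd
  have h := oneArmPolyDecayAtCritical_of_pointwiseTwoPoint_pair (d := d) (le_trans (by norm_num) hd) hb0 hτ
  refine oneArmPolyDecayAtCritical_const_mono h ?_
  have hm0 : 0 < min b 1 := lt_min hb0 one_pos
  have hm1 : min b 1 ≤ 1 := min_le_right b 1
  have hc0 : 0 ≤ min b 1 / (12 * (d : ℝ) + 4) := by positivity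
  have hc1 : min b 1 / (12 * (d : ℝ) + 4) ≤ 1 / 40 := by
    rw [div_le_div_iff₀ (by positivity) (by norm_num)]; nlinarith
  have hk : 2 * d ^ 4 = (2 * d ^ 4 - 1) + 1 := by
    have : 1 ≤ d ^ 4 := Nat.one_le_pow _ _ (by omega)
    omega
  rw [hk]
  exact final_const_add_le hc0 hc1 (Real.rpow_nonneg (mul_nonneg (by positivity) (le_trans (by norm_num) (three_le_aknKappa d _))) _)
    (pairConst_le_uniform hd)

/-! ## §3. Ball hypothesis X_A, bootstrap pair route, every `d ≥ 3`: constant `2^{d⁴} + 3√C` -/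

/-- **`K′_d ≤ 2^{d⁴−1}` for every `d ≥ 3`** (`K′_d^{2d+2} = 10√2·d³(2d)^{4d+2}(8d²+4d+6)7^{2d²}κ_d ≤ 2^{5d⁴+10d²+12d+14} ≤ 2^{(2d+2)(d⁴−1)}`).
[cite: Cerf2015, Prop. 5.2] [cite: DuminilcopinKozmaTassion2020, §7 (38)–(40)] -/
theorem pairConstBall_le_uniform (hd : 3 ≤ d) :
    (10 * Real.sqrt 2 * (d : ℝ) ^ 3 * (2 * (d : ℝ)) ^ (4 * d + 2) * (8 * (d : ℝ) ^ 2 + 4 * d + 6) * 7 ^ (2 * d ^ 2) *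
        aknKappa d (1 / (2 * (d : ℝ)))) ^ (1 / (2 * (d : ℝ) + 2)) ≤ (2 : ℝ) ^ (d ^ 4 - 1) := by
  have hd1 : 1 ≤ d := le_trans (by norm_num) hd
  have hx1 : (1 : ℝ) ≤ d := by exact_mod_cast hd1
  have hκ := aknKappa_window_le_uniform hd
  have hκ0 : 0 ≤ aknKappa d (1 / (2 * (d : ℝ))) := le_trans (by norm_num) (three_le_aknKappa d _)
  have hq : 8 * (d : ℝ) ^ 2 + 4 * d + 6 ≤ (2 : ℝ) ^ (2 * d + 5) := by
    have h2 := natCast_pow_le_two_pow_mul d 2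
    calc 8 * (d : ℝ) ^ 2 + 4 * d + 6 ≤ 18 * (d : ℝ) ^ 2 := by nlinarith
      _ ≤ 32 * (2 : ℝ) ^ (2 * d) := by nlinarith [pow_nonneg (show (0 : ℝ) ≤ 2 by norm_num) (2 * d)]
      _ = (2 : ℝ) ^ (2 * d + 5) := by rw [pow_add]; norm_num; ring
  have hmain : 10 * Real.sqrt 2 * (d : ℝ) ^ 3 * (2 * (d : ℝ)) ^ (4 * d + 2) * (8 * (d : ℝ) ^ 2 + 4 * d + 6) * 7 ^ (2 * d ^ 2) *
        aknKappa d (1 / (2 * (d : ℝ))) ≤ (2 : ℝ) ^ ((2 * d + 2) * (d ^ 4 - 1)) := by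
    calc 10 * Real.sqrt 2 * (d : ℝ) ^ 3 * (2 * (d : ℝ)) ^ (4 * d + 2) * (8 * (d : ℝ) ^ 2 + 4 * d + 6) * 7 ^ (2 * d ^ 2) *
          aknKappa d (1 / (2 * (d : ℝ)))
        ≤ (2 : ℝ) ^ 4 * (2 : ℝ) ^ (3 * d) * (2 : ℝ) ^ (d * (4 * d + 2)) * (2 : ℝ) ^ (2 * d + 5) * (2 : ℝ) ^ (6 * d ^ 2) *
            (2 : ℝ) ^ (5 * d ^ 4 + 5 * d + 5) :=
          mul6_le_mul6 sqrt_two_mul_le.2.1 (natCast_pow_le_two_pow_mul d 3) (two_mul_natCast_pow_le hd1 _) hq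
            (seven_pow_le_two_pow d) hκ (by positivity) (by positivity) (by positivity) (by positivity) (by positivity) hκ0
      _ = (2 : ℝ) ^ (4 + 3 * d + d * (4 * d + 2) + (2 * d + 5) + 6 * d ^ 2 + (5 * d ^ 4 + 5 * d + 5)) := by
          rw [← pow_add, ← pow_add, ← pow_add, ← pow_add, ← pow_add]
      _ ≤ (2 : ℝ) ^ ((2 * d + 2) * (d ^ 4 - 1)) := pow_le_pow_right₀ (by norm_num) (budget_ball hd)
  have hex : (1 / (2 * (d : ℝ) + 2) : ℝ) = 1 / (((2 * d + 2 : ℕ)) : ℝ) := by push_cast; ring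
  rw [hex]
  exact rpow_one_div_le_two_pow (by omega) (mul_nonneg (by positivity) hκ0) hmain

/-- **X_A ⟹ (T1), BOOTSTRAP PAIR ROUTE, CLOSED FORM FOR EVERY `d ≥ 3`**: `Σ_{x ∈ Λ_R} τ_{p_c}(0,x) ≤ C R^{d−a}` for all `R ≥ 1` (`a > 0`) ⟹
`OneArmPolyDecayAtCritical d (min(a,1)/(8d²+4d+6)) (2^{d⁴} + 3√C)`, i.e. **`π_{p_c(ℤ^d)}(n) ≤ (2^{d⁴} + 3√C)·n^{−min(a,1)/(8d²+4d+6)}`**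
(`d = 3..6` numerals: `2^66, 2^128, 2^227, 2^371` in place of `2^81, 2^256, 2^625, 2^1296`).
builds on p205010 (kernel theorem, internal audit signed; external expert review pending).
[cite: Cerf2015, Lemma 7.1 and §10] [cite: DuminilcopinKozmaTassion2020, §7 (38)–(40)] [cite: HeydenreichVanDerHofstad2017, Open Problem 10.1] -/
theorem oneArmPolyDecayAtCritical_of_ballTwoPoint_pair_uniform (hd : 3 ≤ d) {a C : ℝ} (ha0 : 0 < a)
    (hS : ∀ R : ℕ, 1 ≤ R → ∑ z ∈ box d R, tau d (criticalProbI d) 0 z ≤ C * (R : ℝ) ^ ((d : ℝ) - a)) :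
    OneArmPolyDecayAtCritical d (min a 1 / (8 * (d : ℝ) ^ 2 + 4 * d + 6)) ((2 : ℝ) ^ (d ^ 4) + 3 * Real.sqrt C) := by
  have hx3 : (3 : ℝ) ≤ d := by exact_mod_cast hd
  have h := oneArmPolyDecayAtCritical_of_ballTwoPoint_pair (d := d) (le_trans (by norm_num) hd) ha0 hS
  refine oneArmPolyDecayAtCritical_const_mono h ?_
  have hm0 : 0 < min a 1 := lt_min ha0 one_pos
  have hm1 : min a 1 ≤ 1 := min_le_right a 1
  have hc0 : 0 ≤ min a 1 / (8 * (d : ℝ) ^ 2 + 4 * d + 6) := by positivity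
  have hc1 : min a 1 / (8 * (d : ℝ) ^ 2 + 4 * d + 6) ≤ 1 / 40 := by
    rw [div_le_div_iff₀ (by positivity) (by norm_num)]; nlinarith
  have hk : d ^ 4 = (d ^ 4 - 1) + 1 := by
    have : 1 ≤ d ^ 4 := Nat.one_le_pow _ _ (by omega)
    omega
  rw [hk]
  exact final_const_add_le hc0 hc1 (Real.rpow_nonneg (mul_nonneg (by positivity) (le_trans (by norm_num) (three_le_aknKappa d _))) _)
    (pairConstBall_le_uniform hd)

/-! ## §4. Ball hypothesis X_A, φ-pair route, every `d ≥ 3`: constant `2^{3d⁴+d³} + 2√C` -/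

/-- **`K″_d ≤ 2^{2(3d⁴+d³−1)}` for every `d ≥ 3`** (`d = 3`: gen 9's `K″_3 ≤ 2^528 ≤ 2^538`; `d ≥ 4`:
`5√2·d³(2d)^{6d+2}(4d²+4)7^{2d²}κ_d ≤ 2^{5d⁴+12d²+13d+11}`). [cite: Cerf2015, Prop. 5.2] [cite: DuminilCopinTassionEM2016, Thm. 1.1] -/
theorem pairConstCrit_le_uniform (hd : 3 ≤ d) :
    5 * Real.sqrt 2 * (d : ℝ) ^ 3 * (2 * (d : ℝ)) ^ (6 * d + 2) * (4 * (d : ℝ) ^ 2 + 4) * 7 ^ (2 * d ^ 2) *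
        aknKappa d (1 / (2 * (d : ℝ))) ≤ (2 : ℝ) ^ (2 * (3 * d ^ 4 + d ^ 3 - 1)) := by
  rcases Nat.eq_or_lt_of_le hd with rfl | hd4
  · exact pairConstCrit_three_le.trans (pow_le_pow_right₀ (by norm_num) (by norm_num))
  · have hd1 : 1 ≤ d := le_trans (by norm_num) hd
    have hx1 : (1 : ℝ) ≤ d := by exact_mod_cast hd1
    have hκ := aknKappa_window_le_uniform hd
    have hκ0 : 0 ≤ aknKappa d (1 / (2 * (d : ℝ))) := le_trans (by norm_num) (three_le_aknKappa d _)
    have hq : 4 * (d : ℝ) ^ 2 + 4 ≤ (2 : ℝ) ^ (2 * d + 3) := by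
      have h2 := natCast_pow_le_two_pow_mul d 2
      calc 4 * (d : ℝ) ^ 2 + 4 ≤ 8 * (d : ℝ) ^ 2 := by nlinarith
        _ ≤ 8 * (2 : ℝ) ^ (2 * d) := by nlinarith [pow_nonneg (show (0 : ℝ) ≤ 2 by norm_num) (2 * d)]
        _ = (2 : ℝ) ^ (2 * d + 3) := by rw [pow_add]; norm_num; ring
    calc 5 * Real.sqrt 2 * (d : ℝ) ^ 3 * (2 * (d : ℝ)) ^ (6 * d + 2) * (4 * (d : ℝ) ^ 2 + 4) * 7 ^ (2 * d ^ 2) *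
          aknKappa d (1 / (2 * (d : ℝ)))
        ≤ (2 : ℝ) ^ 3 * (2 : ℝ) ^ (3 * d) * (2 : ℝ) ^ (d * (6 * d + 2)) * (2 : ℝ) ^ (2 * d + 3) * (2 : ℝ) ^ (6 * d ^ 2) *
            (2 : ℝ) ^ (5 * d ^ 4 + 5 * d + 5) :=
          mul6_le_mul6 sqrt_two_mul_le.2.2 (natCast_pow_le_two_pow_mul d 3) (two_mul_natCast_pow_le hd1 _) hq
            (seven_pow_le_two_pow d) hκ (by positivity) (by positivity) (by positivity) (by positivity) (by positivity) hκ0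
      _ = (2 : ℝ) ^ (3 + 3 * d + d * (6 * d + 2) + (2 * d + 3) + 6 * d ^ 2 + (5 * d ^ 4 + 5 * d + 5)) := by
          rw [← pow_add, ← pow_add, ← pow_add, ← pow_add, ← pow_add]
      _ ≤ (2 : ℝ) ^ (2 * (3 * d ^ 4 + d ^ 3 - 1)) := pow_le_pow_right₀ (by norm_num) (budget_phi hd4)

/-- **X_A ⟹ (T1), φ-PAIR ROUTE, CLOSED FORM FOR EVERY `d ≥ 3`**: `Σ_{x ∈ Λ_R} τ_{p_c}(0,x) ≤ C R^{d−a}` for all `R ≥ 1` (`a > 0`) ⟹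
`OneArmPolyDecayAtCritical d (min(a,1)/(8d²+8)) (2^{3d⁴+d³} + 2√C)`, i.e. **`π_{p_c(ℤ^d)}(n) ≤ (2^{d³(3d+1)} + 2√C)·n^{−min(a,1)/(8d²+8)}`**
— the best conditional exponent for X_A in the tree, every `d ≥ 3` (`d = 3..6` numerals: `2^265, 2^647, 2^1372, 2^2609` in place of
`2^270, 2^832, 2^2000, 2^4104`).
builds on p205010 (kernel theorem, internal audit signed; external expert review pending).
[cite: Cerf2015, Lemma 6.1, Lemma 7.1 and §10] [cite: DuminilCopinTassionEM2016, Thm. 1.1] [cite: HeydenreichVanDerHofstad2017, Open Problem 10.1] -/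
theorem oneArmPolyDecayAtCritical_of_ballTwoPoint_pair_crit_uniform (hd : 3 ≤ d) {a C : ℝ} (ha0 : 0 < a)
    (hS : ∀ R : ℕ, 1 ≤ R → ∑ z ∈ box d R, tau d (criticalProbI d) 0 z ≤ C * (R : ℝ) ^ ((d : ℝ) - a)) :
    OneArmPolyDecayAtCritical d (min a 1 / (8 * (d : ℝ) ^ 2 + 8)) ((2 : ℝ) ^ (3 * d ^ 4 + d ^ 3) + 2 * Real.sqrt C) := by
  have hx3 : (3 : ℝ) ≤ d := by exact_mod_cast hd
  have hC1 : 1 ≤ C := one_le_const_of_ballTwoPoint (criticalProbI d) hS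
  have h := oneArmPolyDecayAtCritical_of_ballTwoPoint_pair_crit (d := d) (le_trans (by norm_num) hd) ha0 hS
  refine oneArmPolyDecayAtCritical_const_mono h ?_
  have hm0 : 0 < min a 1 := lt_min ha0 one_pos
  have hm1 : min a 1 ≤ 1 := min_le_right a 1
  have hc0 : 0 ≤ min a 1 / (8 * (d : ℝ) ^ 2 + 8) := by positivity
  have hc1 : min a 1 / (8 * (d : ℝ) ^ 2 + 8) ≤ 1 / 40 := by
    rw [div_le_div_iff₀ (by positivity) (by norm_num)]; nlinarith
  have hk : 3 * d ^ 4 + d ^ 3 = (3 * d ^ 4 + d ^ 3 - 1) + 1 := by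
    have : 1 ≤ d ^ 4 := Nat.one_le_pow _ _ (by omega)
    omega
  rw [hk]
  exact final_const_sqrt_le hc0 hc1 (by linarith) (mul_nonneg (by positivity) (le_trans (by norm_num) (three_le_aknKappa d _)))
    (pairConstCrit_le_uniform hd)

end Summit.CriticalPhenomena.PercolationContinuityZ3.Theorems.Quant

end
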